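import Summits.BirchSwinnertonDyer.BirchSwinnertonDyer.Theorems.PAdicOrderV2PAdicOrderComparisonR2OfItemsControlTwo
import Literature.NumberTheory.EllipticCurves.SelmerCorankControlRatOrdinaryProofs

/-!
# Crux #2 `PAdicOrderComparisonR2` modulo ROUTE ITEMS ONLY (line `Sketch`, skeleton v12, lead c3 —
# helper file, `--supports stmt-BirchSwinnertonDyer-0489`)

The one named Literature fact the line still leaned on, Mazur's control theorem in corank form
`Literature.NumberTheory.EllipticCurves.Greenberg1999_coinvariantsRank_eq_selmerCorank_rat`
(Greenberg, LNM 1716, Thm 1.2), was DISCHARGED in tree during this seat's wave 1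
(`Greenberg1999_coinvariantsRank_eq_selmerCorank_rat_holds`,
`Literature/NumberTheory/EllipticCurves/SelmerCorankControlRatOrdinaryProofs.lean`, p137277: Greenberg's
Lemma 3.4 at the layer `n = 0` from the local Kummer skeleton and the ordinary filtration; stub CT
landed as `…Theorems/PAdicOrderV2PAdicOrderComparisonR2StubControl.lean`, p137359). Feeding it into
the landed conditional compositions gives the three statements below with NO Literature hypothesis:

* `pAdicOrderComparisonR2_five_le_of_routeItems` — crux #2 at every good ordinary `p ≥ 5` from the
  six route items 0515, 0131, 0130, 14418, 0509, 15426;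
* `pAdicOrderComparisonR2_odd_of_routeItems` — crux #2 at every ODD good ordinary `p` from the seven
  route items 0515, 0131, 0130, 14418, 0132, 0509, 15426;
* `pAdicOrderComparisonR2_of_routeItems_two` — the crux BY NAME from the seven route items and the
  `p = 2` instances MC2 / SS2 of items 15426 / 0509 (the two registered stubs of skeleton v12).

So after this file crux #2 is, machine-checked, an ASSEMBLY of route PAdicOrderV2's cruxes #4, #5,
#7 and route SelmerRank's cruxes LB / UB / SmallImage / ShaPFinite at every odd prime, and of the
same plus IMC₂ ∧ semisimplicity₂ at `p = 2`.

References: B. Mazur, J. Tate, J. Teitelbaum, Invent. Math. 84 (1986), §II.10; R. Greenberg, LNM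
1716 (1999), Thm 1.2; K. Kato, Astérisque 295 (2004), Thm 17.4.
-/

-- the problem directory `BirchSwinnertonDyer/BirchSwinnertonDyer` forces the duplicated namespace segment
set_option linter.dupNamespace false

namespace Summit.BirchSwinnertonDyer.BirchSwinnertonDyer.Theorems

open Literature.NumberTheory.EllipticCurves

/-- **Crux #2 at every good ordinary `p ≥ 5` from the six route items alone** (crux #5
`PAdicOrderRankOneR4`, `SelmerRankLB`, `SelmerRankUB`, `SelmerRankSmallImage`, crux #4
`PAdicOrderSemisimpleR3`, crux #7 `PAdicOrderMainConjectureR7`): the landed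
`pAdicOrderComparisonR2_five_le_of_items` with Mazur control discharged
(`Greenberg1999_coinvariantsRank_eq_selmerCorank_rat_holds`). [cite: MazurTateTeitelbaum1986Invent, §II.10] -/
theorem pAdicOrderComparisonR2_five_le_of_routeItems :
    Summit.BirchSwinnertonDyer.BirchSwinnertonDyer.Theses.PAdicOrderV2.PAdicOrderRankOneR4 →
    Summit.BirchSwinnertonDyer.BirchSwinnertonDyer.Theses.SelmerRank.SelmerRankLB →
    Summit.BirchSwinnertonDyer.BirchSwinnertonDyer.Theses.SelmerRank.SelmerRankUB →
    Summit.BirchSwinnertonDyer.BirchSwinnertonDyer.Theses.SelmerRank.SelmerRankSmallImage →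
    Summit.BirchSwinnertonDyer.BirchSwinnertonDyer.Theses.PAdicOrderV2.PAdicOrderSemisimpleR3 →
    Summit.BirchSwinnertonDyer.BirchSwinnertonDyer.Theses.PAdicOrderV2.PAdicOrderMainConjectureR7 →
    ∀ (W : WeierstrassCurve ℚ) [W.IsElliptic] [W.IsGloballyMinimal] (p : ℕ) [Fact p.Prime],
      5 ≤ p → Literature.NumberTheory.EllipticCurves.IsOrdinaryAt W p → ∀ {N : ℕ} [NeZero N] (f : CuspForm (CongruenceSubgroup.Gamma0 N) 2), Literature.NumberTheory.EllipticCurves.ModularForms.IsNewformOf W f → (Literature.NumberTheory.EllipticCurves.padicLFunction f (Literature.NumberTheory.EllipticCurves.unitRoot W p : ℚ_[p])).order = W.analyticRank :=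
  fun h5 hLB hUB hSI hSS hMC =>
    pAdicOrderComparisonR2_five_le_of_items h5 hLB hUB hSI hSS hMC
      Greenberg1999_coinvariantsRank_eq_selmerCorank_rat_holds

/-- **Crux #2 at every ODD good ordinary prime from the seven route items alone** (crux #5
`PAdicOrderRankOneR4`, `SelmerRankLB`, `SelmerRankUB`, `SelmerRankSmallImage`, `SelmerRankShaPFinite`,
crux #4 `PAdicOrderSemisimpleR3`, crux #7 `PAdicOrderMainConjectureR7`): the landed
`pAdicOrderComparisonR2_odd_of_items` with Mazur control discharged
(`Greenberg1999_coinvariantsRank_eq_selmerCorank_rat_holds`). [cite: MazurTateTeitelbaum1986Invent, §II.10] -/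
theorem pAdicOrderComparisonR2_odd_of_routeItems :
    Summit.BirchSwinnertonDyer.BirchSwinnertonDyer.Theses.PAdicOrderV2.PAdicOrderRankOneR4 →
    Summit.BirchSwinnertonDyer.BirchSwinnertonDyer.Theses.SelmerRank.SelmerRankLB →
    Summit.BirchSwinnertonDyer.BirchSwinnertonDyer.Theses.SelmerRank.SelmerRankUB →
    Summit.BirchSwinnertonDyer.BirchSwinnertonDyer.Theses.SelmerRank.SelmerRankSmallImage →
    Summit.BirchSwinnertonDyer.BirchSwinnertonDyer.Theses.SelmerRank.SelmerRankShaPFinite →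
    Summit.BirchSwinnertonDyer.BirchSwinnertonDyer.Theses.PAdicOrderV2.PAdicOrderSemisimpleR3 →
    Summit.BirchSwinnertonDyer.BirchSwinnertonDyer.Theses.PAdicOrderV2.PAdicOrderMainConjectureR7 →
    ∀ (W : WeierstrassCurve ℚ) [W.IsElliptic] [W.IsGloballyMinimal] (p : ℕ) [Fact p.Prime],
      p ≠ 2 → Literature.NumberTheory.EllipticCurves.IsOrdinaryAt W p → ∀ {N : ℕ} [NeZero N] (f : CuspForm (CongruenceSubgroup.Gamma0 N) 2), Literature.NumberTheory.EllipticCurves.ModularForms.IsNewformOf W f → (Literature.NumberTheory.EllipticCurves.padicLFunction f (Literature.NumberTheory.EllipticCurves.unitRoot W p : ℚ_[p])).order = W.analyticRank :=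
  fun h5 hLB hUB hSI hSha hSS hMC =>
    pAdicOrderComparisonR2_odd_of_items h5 hLB hUB hSI hSha hSS hMC
      Greenberg1999_coinvariantsRank_eq_selmerCorank_rat_holds

/-- **Crux #2 `PAdicOrderComparisonR2` BY NAME from the seven route items and the `p = 2` instances
MC2 (of item 15426, the main conjecture in `Λ ⊗ ℚ₂`) and SS2 (of item 0509, `T`-semisimplicity at
`p = 2`)** — the landed `pAdicOrderComparisonR2_of_items_control_two` with Mazur control discharged
(`Greenberg1999_coinvariantsRank_eq_selmerCorank_rat_holds`). MC2 and SS2 are the two registered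
stubs of skeleton v12 of line `Sketch`; they are statements beyond print at `p = 2` (Kato's half of
MC2 is printed parity-free, Astérisque 295 Thm 17.4 (1)(2)). [cite: MazurTateTeitelbaum1986Invent, §II.10]
[cite: GreenbergLNM1716, §1 Conj. 1.12–1.13 (pp. 64–65)] -/
theorem pAdicOrderComparisonR2_of_routeItems_two :
    Summit.BirchSwinnertonDyer.BirchSwinnertonDyer.Theses.PAdicOrderV2.PAdicOrderRankOneR4 →
    Summit.BirchSwinnertonDyer.BirchSwinnertonDyer.Theses.SelmerRank.SelmerRankLB →
    Summit.BirchSwinnertonDyer.BirchSwinnertonDyer.Theses.SelmerRank.SelmerRankUB →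
    Summit.BirchSwinnertonDyer.BirchSwinnertonDyer.Theses.SelmerRank.SelmerRankSmallImage →
    Summit.BirchSwinnertonDyer.BirchSwinnertonDyer.Theses.SelmerRank.SelmerRankShaPFinite →
    Summit.BirchSwinnertonDyer.BirchSwinnertonDyer.Theses.PAdicOrderV2.PAdicOrderSemisimpleR3 →
    Summit.BirchSwinnertonDyer.BirchSwinnertonDyer.Theses.PAdicOrderV2.PAdicOrderMainConjectureR7 →
    (∀ (W : WeierstrassCurve ℚ) [W.IsElliptic] [W.IsGloballyMinimal] (p : ℕ) [Fact p.Prime], p = 2 → W.HasGoodReductionAtPrime p → ¬ (p : ℤ) ∣ W.frobeniusTrace p → ∀ (κ : Literature.NumberTheory.EllipticCurves.ZpExtension ℚ p) (γ : Field.absoluteGaloisGroup ℚ), κ.IsCyclotomic → κ.IsTopGenerator γ → Literature.NumberTheory.EllipticCurves.IsCyclotomicVariable p γ → ∀ {N : ℕ} [NeZero N] (f : CuspForm (CongruenceSubgroup.Gamma0 N) 2), Literature.NumberTheory.EllipticCurves.ModularForms.IsNewformOf W f → ∀ (D : W.SelmerDualData κ γ), D.IsTorsion ∧ ∃ (g :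 Literature.NumberTheory.EllipticCurves.IwasawaAlgebra p) (k : ℤ), D.charIdeal = Ideal.span {g} ∧ Literature.NumberTheory.EllipticCurves.iwasawaToPowerSeries p g = PowerSeries.C ((p : ℚ_[p]) ^ k) * Literature.NumberTheory.EllipticCurves.padicLFunction f (Literature.NumberTheory.EllipticCurves.unitRoot W p : ℚ_[p])) →
    (∀ (W : WeierstrassCurve ℚ) [W.IsElliptic] [W.IsGloballyMinimal] (p : ℕ) [Fact p.Prime], p = 2 → W.HasGoodReductionAtPrime p → ¬ (p : ℤ) ∣ W.frobeniusTrace p → ∀ (κ : Literature.NumberTheory.EllipticCurves.ZpExtension ℚ p) (γ : Field.absoluteGaloisGroup ℚ), κ.IsCyclotomic → κ.IsTopGenerator γ → ∀ (D : W.SelmerDualData κ γ) (x : D.X), (∃ k : ℕ, (PowerSeries.C ((p : ℤ_[p]) ^ k) * PowerSeries.X ^ 2 : Literature.NumberTheory.EllipticCurves.IwasawaAlgebra p) • x = 0) → ∃ k : ℕ, (PowerSeries.C ((p : ℤ_[p]) ^ k) * PowerSeries.X : Literature.NumberTheory.EllipticCurves.IwasawaAlgebra p) • x = 0) →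
    Summit.BirchSwinnertonDyer.BirchSwinnertonDyer.Theses.PAdicOrderV2.PAdicOrderComparisonR2 :=
  fun h5 hLB hUB hSI hSha hSS hMC hMC2 hSS2 =>
    pAdicOrderComparisonR2_of_items_control_two h5 hLB hUB hSI hSha hSS hMC
      Greenberg1999_coinvariantsRank_eq_selmerCorank_rat_holds hMC2 hSS2

end Summit.BirchSwinnertonDyer.BirchSwinnertonDyer.Theorems
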